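import Literature.Analysis.Fourier.ChirpAliasKernelLimit
import Literature.Analysis.Fourier.ChirpEulerMaclaurin
import HarnessLib

/-!
# The aliased remainder of the chirped Euler–Maclaurin formula as a smooth kernel

For a chirp phase `φ` (`ChirpPhase φ H L Cφ`), a weight `w` (continuous, smooth on `(H, ∞)`,
uniform symbol of order `0` — e.g. `1/φ'`, `φ''/φ'²`), a cut-off `χ` (smooth, supported in
`[-c', c']`, `c' < 2πL`, equal to `1` on `[-a, a]`) and the smooth kernel `K` of
`ChirpAliasKernelLimit.lean`, we prove the **alias expansion**
`∫_{τ>H} Ĝ(τ) ρ_H(τ) w(τ) (P(φ(τ)) + 1/12) dτ = ∫ G(x) K(x) dx`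
for every continuous `G` supported in `[-a, a]` with `Ĝ w` integrable on `(H, ∞)`
(`Ĝ(τ) = ∫ G(x) e^{ixτ} dx`, `P` the periodic Bernoulli function `perB2`):
expand `P + 1/12 = Σ_{k≥1} cos(2πkφ)/(2π²k²)` under the truncated integral (dominated
convergence for series), pair each mode with `G` by Fubini (`integral_ft_mul_truncAmp_pair`),
and remove the truncation (`T = m + 1 → ∞`) using the uniform kernel bounds and the uniform
convergence of the partial sums `aliasSum`. Source: Stein, *Harmonic Analysis* (1993), VIII §1
(non-stationary phase); Olver (1974), Ch. 8 (Euler–Maclaurin). We also record the (much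
simpler) near kernels `∫_{τ>H} Ĝ(τ) f(τ) dτ = ∫ G · aliasKT φ (H-1) (cutBelow H f) 0` for
amplitudes `f` living on a bounded part of `[H, ∞)` with `f(H) = 0` (extension by zero,
`cutBelow`). Everything is proved; the only definition is `cutBelow`, no named facts.
-/

noncomputable section

open Set Filter MeasureTheory
open scoped Topology ContDiff Real

namespace Literature.Analysis.Fourier

open _root_.Complex (I exp)

/-! ## Small tools -/

/-- `τ ↦ Ĝ(τ) = ∫ G(x) e^{ixτ} dx` is continuous for continuous compactly supported `G`.
[folklore] -/
theorem continuous_ft {G : ℝ → ℂ} (hG : Continuous G) (hGs : HasCompactSupport G) :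
    Continuous fun τ : ℝ => ∫ x, G x * exp (((x * τ : ℝ) : ℂ) * I) := by
  have heq : (fun τ : ℝ => ∫ x, G x * exp (((x * τ : ℝ) : ℂ) * I)) =
      fun τ : ℝ => ∫ x in tsupport G, G x * exp (((x * τ : ℝ) : ℂ) * I) := by
    funext τ
    refine (setIntegral_eq_integral_of_forall_compl_eq_zero fun x hx => ?_).symm
    simp [image_eq_zero_of_notMem_tsupport hx]
  rw [heq]
  exact continuous_parametric_integral_of_continuous
    (f := fun (τ : ℝ) (x : ℝ) => G x * exp (((x * τ : ℝ) : ℂ) * I)) (by fun_prop) hGs.isCompact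

/-- If `‖Ψ(x)‖ ≤ U` for `|x| ≤ c'` and `G` is supported in `[-a, a] ⊆ [-c', c']`, then
`‖∫ G Ψ‖ ≤ U ∫ ‖G‖`. [folklore] -/
theorem norm_integral_mul_le_of_tsupport {G Ψ : ℝ → ℂ} (hG : Continuous G)
    (hGs : HasCompactSupport G) {a c' U : ℝ} (hGa : tsupport G ⊆ Icc (-a) a) (hac : a ≤ c')
    (hΨ : ∀ x, |x| ≤ c' → ‖Ψ x‖ ≤ U) :
    ‖∫ x, G x * Ψ x‖ ≤ U * ∫ x, ‖G x‖ := by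
  have hGi : Integrable fun x => ‖G x‖ := hG.norm.integrable_of_hasCompactSupport hGs.norm
  rw [← integral_const_mul]
  refine norm_integral_le_of_norm_le (hGi.const_mul U) (Eventually.of_forall fun x => ?_)
  by_cases hx : x ∈ tsupport G
  · have hxa : |x| ≤ c' := by
      have := hGa hx
      rw [mem_Icc] at this
      exact abs_le.mpr ⟨by linarith [this.1], by linarith [this.2]⟩
    rw [norm_mul, mul_comm U]
    exact mul_le_mul_of_nonneg_left (hΨ x hxa) (norm_nonneg _)
  · simp [image_eq_zero_of_notMem_tsupport hx]

/-- `e^{iθ} + e^{-iθ} = 2 cos θ` in the form produced by the modes `k` and `-k`. [folklore] -/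
theorem exp_mode_add_exp_neg_mode (k : ℤ) (y : ℝ) :
    exp (((2 * π * k * y : ℝ) : ℂ) * I) + exp (((2 * π * (-k : ℤ) * y : ℝ) : ℂ) * I) =
      ((2 * Real.cos (2 * π * k * y) : ℝ) : ℂ) := by
  push_cast
  rw [Complex.two_cos]
  congr 1
  congr 1
  ring

/-- If `χ = 1` on `[-a, a] ⊇ tsupport G` then `G χ = G`. [folklore] -/
theorem mul_cutoff_eq_self {G χ : ℝ → ℂ} {a : ℝ} (hGa : tsupport G ⊆ Icc (-a) a)
    (hχ1 : ∀ x ∈ Icc (-a) a, χ x = 1) (x : ℝ) : G x * χ x = G x := by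
  by_cases hx : x ∈ tsupport G
  · rw [hχ1 x (hGa hx), mul_one]
  · simp [image_eq_zero_of_notMem_tsupport hx]

/-! ## The alias expansion -/

section Expansion

variable {φ : ℝ → ℝ} {H L : ℝ} {Cφ : ℕ → ℝ} (hφ : ChirpPhase φ H L Cφ)
  {w : ℝ → ℝ} (hwc : Continuous w) (hws : ContDiffOn ℝ ∞ w (Ioi H))
  (hwb : ∀ R, SymBnd (univ : Set Unit) H 0 R (fun _ => w))
  {c' : ℝ} (hc' : 0 ≤ c') (hcL : c' < 2 * π * L)

include hφ hwc in
/-- **Termwise integration of the Fourier series of `P` under the truncated integral.** For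
`T > 0` and continuous compactly supported `G`:
`Σ_{k≥0} b_k ∫ G P_T(k+1) = ∫_{τ>H} Ĝ a_T (P(φ) + 1/12)`. [folklore] -/
theorem hasSum_b2coef_mul_integral_aliasPairT {T : ℝ} (hT : 0 < T) {G : ℝ → ℂ}
    (hG : Continuous G) (hGs : HasCompactSupport G) :
    HasSum (fun k : ℕ => (b2coef k : ℂ) * ∫ x, G x * aliasPairT φ H w T (k + 1) x)
      (∫ τ in Ioi H, (∫ x, G x * exp (((x * τ : ℝ) : ℂ) * I)) * (truncAmp H w T τ : ℂ) *
        ((perB2 (φ τ) + 1 / 12 : ℝ) : ℂ)) := by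
  have hφc := hφ.smooth.continuous
  set F : ℝ → ℂ := fun τ => ∫ x, G x * exp (((x * τ : ℝ) : ℂ) * I) with hF
  have hFc : Continuous F := continuous_ft hG hGs
  have hz := fun (τ : ℝ) (hτ : τ < H + 1 / 4) => truncAmp_eq_zero_of_lt (H := H) (w := w) T hτ
  have hR := fun (τ : ℝ) (hτ : 2 * T < τ) => truncAmp_eq_zero_of_gt (H := H) (w := w) hT hτ
  -- the modes
  set E : ℕ → ℝ → ℂ := fun k τ => exp (((2 * π * ((k : ℤ) + 1 : ℤ) * φ τ : ℝ) : ℂ) * I) +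
    exp (((2 * π * (-((k : ℤ) + 1) : ℤ) * φ τ : ℝ) : ℂ) * I) with hE
  have hEc : ∀ k, Continuous (E k) := fun k => by simp only [hE]; fun_prop
  have hEn : ∀ k τ, ‖E k τ‖ ≤ 2 := fun k τ => by
    simp only [hE]
    refine (norm_add_le _ _).trans ?_
    rw [Complex.norm_exp_ofReal_mul_I, Complex.norm_exp_ofReal_mul_I]
    norm_num
  have hEcos : ∀ k τ, E k τ = ((2 * Real.cos (2 * π * (((k : ℤ) + 1 : ℤ) : ℝ) * φ τ) : ℝ) : ℂ) :=
    fun k τ => exp_mode_add_exp_neg_mode _ _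
  -- the summands
  set Fn : ℕ → ℝ → ℂ := fun k τ => (b2coef k : ℂ) * (F τ * (truncAmp H w T τ : ℂ) * E k τ)
    with hFn
  have hpair : ∀ k : ℕ, ∫ x, G x * aliasPairT φ H w T (k + 1) x =
      ∫ τ in Ioi H, F τ * (truncAmp H w T τ : ℂ) * E k τ := fun k => by
    rw [← integral_ft_mul_truncAmp_pair hφc hwc hT ((k : ℤ) + 1) hG hGs]
  have key := hasSum_integral_of_dominated_convergence (μ := volume.restrict (Ioi H)) (F := Fn)
    (f := fun τ => F τ * (truncAmp H w T τ : ℂ) * ((perB2 (φ τ) + 1 / 12 : ℝ) : ℂ))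
    (fun k τ => b2coef k * (2 * ‖F τ * (truncAmp H w T τ : ℂ)‖)) (fun k => ?_) (fun k => ?_) ?_
    ?_ ?_
  · have heq : (fun k : ℕ => ∫ τ in Ioi H, Fn k τ) =
        fun k : ℕ => (b2coef k : ℂ) * ∫ x, G x * aliasPairT φ H w T (k + 1) x := by
      funext k
      rw [hpair k, ← integral_const_mul]
    rwa [heq] at key
  · exact (continuous_const.mul ((hFc.mul (Complex.continuous_ofReal.comp
      (continuous_truncAmp hwc T))).mul (hEc k))).aestronglyMeasurable
  · refine Eventually.of_forall fun τ => ?_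
    simp only [hFn]
    rw [norm_mul, Complex.norm_real, Real.norm_of_nonneg (b2coef_nonneg k), norm_mul]
    refine mul_le_mul_of_nonneg_left ?_ (b2coef_nonneg k)
    rw [mul_comm]
    exact mul_le_mul_of_nonneg_right (hEn k τ) (norm_nonneg _)
  · exact Eventually.of_forall fun τ => summable_b2coef.mul_right _
  · have h1 : IntegrableOn (fun τ => 2 * ‖F τ * (truncAmp H w T τ : ℂ)‖) (Ioi H) := by
      refine integrableOn_Ioi_of_zero (R := 2 * T) ?_ (fun τ hτ => by simp [hz τ hτ])
        (fun τ hτ => by simp [hR τ hτ])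
      exact (continuous_const.mul (hFc.mul (Complex.continuous_ofReal.comp
        (continuous_truncAmp hwc T))).norm).continuousOn
    refine ((h1.const_mul (∑' k, b2coef k)).congr ?_)
    exact Eventually.of_forall fun τ => by simp only; rw [tsum_mul_right]
  · refine Eventually.of_forall fun τ => ?_
    have h1 := (Complex.hasSum_ofReal.mpr (hasSum_perB2_succ (φ τ))).mul_left
      (F τ * (truncAmp H w T τ : ℂ))
    refine (h1.congr_fun fun k => ?_)  -- hmm: HasSum.congr_fun direction
    simp only [hFn, hEcos]
    unfold b2coef
    push_cast
    have : ((k : ℝ) : ℂ) + 1 ≠ 0 := by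
      norm_cast
    have hπ : (π : ℂ) ≠ 0 := Complex.ofReal_ne_zero.mpr Real.pi_ne_zero
    field_simp
    ring

include hφ hwc hws hwb hc' hcL in
/-- **The alias expansion as a smooth kernel.** There is a smooth `K` (the limit kernel of
`ChirpAliasKernelLimit.lean`) such that for every continuous `G` supported in `[-a, a]`
(`a ≤ c'`, `χ = 1` on `[-a, a]`) with `Ĝ w` integrable on `(H, ∞)`:
`∫_{τ>H} Ĝ(τ) ρ_H(τ) w(τ) (P(φ(τ)) + 1/12) dτ = ∫ G(x) K(x) dx`. [folklore] -/
theorem exists_kernel_alias_expansion {χ : ℝ → ℂ} (hχ : ContDiff ℝ ∞ χ)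
    (hχs : tsupport χ ⊆ Icc (-c') c') {a : ℝ} (hac : a ≤ c') (hχ1 : ∀ x ∈ Icc (-a) a, χ x = 1) :
    ∃ K : ℝ → ℂ, ContDiff ℝ ∞ K ∧ ∀ G : ℝ → ℂ, Continuous G → HasCompactSupport G →
      tsupport G ⊆ Icc (-a) a →
      IntegrableOn (fun τ => (∫ x, G x * exp (((x * τ : ℝ) : ℂ) * I)) * (w τ : ℂ)) (Ioi H) →
      ∫ τ in Ioi H, (∫ x, G x * exp (((x * τ : ℝ) : ℂ) * I)) * ((rhoCut H τ * w τ : ℝ) : ℂ) *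
          ((perB2 (φ τ) + 1 / 12 : ℝ) : ℂ) = ∫ x, G x * K x := by
  obtain ⟨K, hK, hKlim⟩ := exists_contDiff_tendstoUniformly_aliasSum hφ hwc hws hwb hc' hcL hχ hχs
  obtain ⟨U, hU0, hU⟩ := exists_aliasPairT_le hφ hwc hws hwb hc' hcL
  refine ⟨K, hK, fun G hG hGs hGa hWi => ?_⟩
  have hφc := hφ.smooth.continuous
  set F : ℝ → ℂ := fun τ => ∫ x, G x * exp (((x * τ : ℝ) : ℂ) * I) with hF
  have hFc : Continuous F := continuous_ft hG hGs
  have hGχ : ∀ x, G x * χ x = G x := mul_cutoff_eq_self hGa hχ1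
  set Pt : ℝ → ℂ := fun τ => ((perB2 (φ τ) + 1 / 12 : ℝ) : ℂ) with hPt
  have hPtc : Continuous Pt :=
    Complex.continuous_ofReal.comp ((continuous_perB2.comp hφc).add continuous_const)
  have hPtn : ∀ τ, ‖Pt τ‖ ≤ 1 := fun τ => by
    simp only [hPt, Complex.norm_real, Real.norm_eq_abs]
    have := abs_perB2_le (φ τ)
    rw [abs_le] at this ⊢
    constructor <;> linarith [this.1, this.2]
  -- the truncated integrals `V m` and the paired sums
  set V : ℕ → ℂ := fun m => ∫ τ in Ioi H, F τ * (truncAmp H w (m + 1) τ : ℂ) * Pt τ with hV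
  set f : ℕ → ℕ → ℂ := fun m k => (b2coef k : ℂ) * ∫ x, G x * aliasPairT φ H w (m + 1) (k + 1) x
    with hf
  have hm1 : ∀ m : ℕ, (1 : ℝ) ≤ m + 1 := fun m => by
    have := (Nat.cast_nonneg m : (0 : ℝ) ≤ m); linarith
  have hA : ∀ m : ℕ, HasSum (f m) (V m) := fun m =>
    hasSum_b2coef_mul_integral_aliasPairT hφ hwc (T := (m : ℝ) + 1) (by linarith [hm1 m]) hG hGs
  show ∫ τ in Ioi H, F τ * ((rhoCut H τ * w τ : ℝ) : ℂ) * Pt τ = ∫ x, G x * K x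
  clear_value Pt
  -- Step B: `V m - ∫ G S_m → 0`
  set nG : ℝ := ∫ x, ‖G x‖ with hnG
  have hnG0 : 0 ≤ nG := integral_nonneg fun x => norm_nonneg _
  have hfb : ∀ m k, ‖f m k‖ ≤ b2coef k * (U * nG) := fun m k => by
    simp only [hf]
    rw [norm_mul, Complex.norm_real, Real.norm_of_nonneg (b2coef_nonneg k)]
    exact mul_le_mul_of_nonneg_left (norm_integral_mul_le_of_tsupport hG hGs hGa hac
      fun x hx => hU k x hx _ (hm1 m)) (b2coef_nonneg k)
  have hS : ∀ m, ∫ x, G x * aliasSum φ H w χ m x = ∑ k ∈ Finset.range m, f m k := fun m => by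
    rw [integral_mul_aliasSum hφ hwc hχ.continuous hG hGs m]
    refine Finset.sum_congr rfl fun k _ => ?_
    simp only [hf]
    congr 1
    refine integral_congr_ae (Eventually.of_forall fun x => ?_)
    simp only
    rw [← mul_assoc, hGχ]
  have hB : Tendsto (fun m => V m - ∫ x, G x * aliasSum φ H w χ m x) atTop (𝓝 0) := by
    have htail : ∀ m, V m - ∫ x, G x * aliasSum φ H w χ m x = ∑' k, f m (k + m) := fun m => by
      rw [hS m, ← (hA m).tsum_eq, ← (hA m).summable.sum_add_tsum_nat_add m]
      ring
    simp_rw [htail]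
    have hlim : Tendsto (fun m : ℕ => (∑' k, b2coef (k + m)) * (U * nG)) atTop (𝓝 0) := by
      have := (tendsto_sum_nat_add b2coef).mul_const (U * nG)
      simpa using this
    refine squeeze_zero_norm (fun m => ?_) hlim
    refine tsum_of_norm_bounded ?_ fun k => hfb m (k + m)
    exact ((summable_nat_add_iff m).mpr summable_b2coef).hasSum.mul_right _
  -- Step C: `V m → ∫ Ĝ ρ w (P + 1/12)`
  have hC : Tendsto V atTop
      (𝓝 (∫ τ in Ioi H, F τ * ((rhoCut H τ * w τ : ℝ) : ℂ) * Pt τ)) := by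
    refine tendsto_integral_of_dominated_convergence (μ := volume.restrict (Ioi H))
      (fun τ => ‖F τ * (w τ : ℂ)‖) (fun m => ?_) hWi.norm (fun m => ?_) ?_
    · exact ((hFc.mul (Complex.continuous_ofReal.comp (continuous_truncAmp hwc _))).mul
        hPtc).aestronglyMeasurable
    · refine Eventually.of_forall fun τ => ?_
      have h1 := abs_rhoCut_le H τ
      have h2 := abs_etaCut_le ((m : ℝ) + 1) τ
      have h3 := hPtn τ
      have e1 : ‖F τ * (truncAmp H w (m + 1) τ : ℂ) * Pt τ‖ =
          ‖F τ‖ * (|rhoCut H τ| * |etaCut (m + 1) τ| * |w τ|) * ‖Pt τ‖ := by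
        rw [norm_mul, norm_mul, Complex.norm_real, Real.norm_eq_abs, truncAmp, abs_mul, abs_mul]
      have e2 : ‖F τ * (w τ : ℂ)‖ = ‖F τ‖ * |w τ| := by
        rw [norm_mul, Complex.norm_real, Real.norm_eq_abs]
      rw [e1, e2]
      calc ‖F τ‖ * (|rhoCut H τ| * |etaCut (m + 1) τ| * |w τ|) * ‖Pt τ‖
          ≤ ‖F τ‖ * (1 * 1 * |w τ|) * 1 := by gcongr
        _ = ‖F τ‖ * |w τ| := by ring
    · refine Eventually.of_forall fun τ => ?_
      refine tendsto_const_nhds.congr' ?_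
      filter_upwards [eventually_ge_atTop ⌈τ⌉₊] with m hm
      have hτm : τ ≤ (m : ℝ) + 1 := by
        have := Nat.le_ceil τ
        have : (⌈τ⌉₊ : ℝ) ≤ m := by exact_mod_cast hm
        linarith
      simp only [truncAmp, etaCut_eq_one (by linarith [hm1 m] : (0 : ℝ) < m + 1) hτm]
      push_cast
      ring
  -- Step D: `∫ G S_m → ∫ G K`
  have hD : Tendsto (fun m => ∫ x, G x * aliasSum φ H w χ m x) atTop (𝓝 (∫ x, G x * K x)) := by
    refine tendsto_integral_filter_of_dominated_convergence (fun x => ‖G x‖ * (‖K x‖ + 1))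
      (Eventually.of_forall fun m => ?_) ?_ ?_ (Eventually.of_forall fun x => ?_)
    · exact (hG.mul (contDiff_aliasSum hφ hwc hχ m).continuous).aestronglyMeasurable
    · filter_upwards [Metric.tendstoUniformly_iff.1 hKlim 1 one_pos] with m hm
      refine Eventually.of_forall fun x => ?_
      rw [norm_mul]
      refine mul_le_mul_of_nonneg_left ?_ (norm_nonneg _)
      have := hm x
      rw [dist_eq_norm] at this
      linarith [norm_le_insert (K x) (aliasSum φ H w χ m x)]
    · exact (hG.norm.mul (hK.continuous.norm.add continuous_const)).integrable_of_hasCompactSupport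
        (hGs.norm.mul_right)
    · exact (hKlim.tendsto_at x).const_mul (G x) |>.congr fun m => rfl
  -- conclusion
  have hV' : Tendsto V atTop (𝓝 (∫ x, G x * K x)) := by
    have := hD.add hB
    rw [add_zero] at this
    exact this.congr fun m => by ring
  exact tendsto_nhds_unique hC hV'

end Expansion

/-! ## Near kernels: amplitudes living on `[H, H + 1/2]` -/

/-- Extension by zero below `H`: `cutBelow H f t = f t` for `t ≥ H`, `0` for `t < H`.
[folklore] -/
def cutBelow (H : ℝ) (f : ℝ → ℝ) (t : ℝ) : ℝ := if H ≤ t then f t else 0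

/-- `cutBelow H f = f` on `[H, ∞)`. [folklore] -/
theorem cutBelow_of_le {H t : ℝ} (f : ℝ → ℝ) (h : H ≤ t) : cutBelow H f t = f t := if_pos h

/-- `cutBelow H f = 0` below `H`. [folklore] -/
theorem cutBelow_of_lt {H t : ℝ} (f : ℝ → ℝ) (h : t < H) : cutBelow H f t = 0 :=
  if_neg (not_le.mpr h)

/-- `cutBelow H f` is continuous when `f` is continuous on `[H, ∞)` and `f(H) = 0`. [folklore] -/
theorem continuous_cutBelow {H : ℝ} {f : ℝ → ℝ} (hf : ContinuousOn f (Ici H)) (h0 : f H = 0) :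
    Continuous (cutBelow H f) := by
  refine continuous_if_le continuous_const continuous_id hf continuousOn_const ?_
  rintro x rfl
  exact h0

section Near

variable {φ : ℝ → ℝ} (hφ : Continuous φ) {H : ℝ} {f : ℝ → ℝ} (hf : ContinuousOn f (Ici H))
  (h0 : f H = 0) {R : ℝ} (hR : ∀ τ, R < τ → f τ = 0)

include hR in
/-- `cutBelow H f` vanishes beyond `R` when `f` does. [folklore] -/
theorem cutBelow_eq_zero_of_gt (τ : ℝ) (hτ : R < τ) : cutBelow H f τ = 0 := by
  unfold cutBelow
  split_ifs
  · exact hR τ hτ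
  · rfl

include hφ hf h0 hR in
/-- The near kernel `x ↦ ∫_{τ>H} f(τ) e^{ixτ} dτ = aliasKT φ (H-1) (cutBelow H f) 0 x` is smooth.
[folklore] -/
theorem contDiff_aliasKT_cutBelow : ContDiff ℝ ∞ (aliasKT φ (H - 1) (cutBelow H f) 0) :=
  contDiff_aliasKT hφ (continuous_cutBelow hf h0)
    (fun τ hτ => cutBelow_of_lt f (by linarith)) (cutBelow_eq_zero_of_gt hR) 0

include hφ hf h0 hR in
/-- **Fubini for the near kernels.** For `f` continuous on `[H, ∞)` with `f(H) = 0` and `f = 0`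
beyond `R`, and continuous compactly supported `G`:
`∫_{τ>H} Ĝ(τ) f(τ) dτ = ∫ G(x) · aliasKT φ (H-1) (cutBelow H f) 0 (x) dx`. [folklore] -/
theorem integral_ft_mul_eq_integral_mul_aliasKT_cutBelow {G : ℝ → ℂ} (hG : Continuous G)
    (hGs : HasCompactSupport G) :
    ∫ τ in Ioi H, (∫ x, G x * exp (((x * τ : ℝ) : ℂ) * I)) * (f τ : ℂ) =
      ∫ x, G x * aliasKT φ (H - 1) (cutBelow H f) 0 x := by
  have key := integral_ft_mul_eq_integral_mul_aliasKT (H := H - 1) hφ (continuous_cutBelow hf h0)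
    (fun τ hτ => cutBelow_of_lt f (by linarith)) (cutBelow_eq_zero_of_gt hR) 0 hG hGs
  rw [← key]
  have h1 : ∫ τ in Ioi (H - 1), (∫ x, G x * exp (((x * τ : ℝ) : ℂ) * I)) *
      (cutBelow H f τ : ℂ) * exp (((2 * π * (0 : ℤ) * φ τ : ℝ) : ℂ) * I) =
      ∫ τ in Ioi H, (∫ x, G x * exp (((x * τ : ℝ) : ℂ) * I)) *
        (cutBelow H f τ : ℂ) * exp (((2 * π * (0 : ℤ) * φ τ : ℝ) : ℂ) * I) := by
    refine setIntegral_eq_of_subset_of_forall_sdiff_eq_zero (t := Ioi (H - 1)) (s := Ioi H)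
      measurableSet_Ioi (Ioi_subset_Ioi (by linarith)) fun τ hτ => ?_
    have hτH : τ ≤ H := not_lt.mp hτ.2
    rcases hτH.eq_or_lt with h | h
    · simp [h, cutBelow, h0]
    · simp [cutBelow_of_lt f h]
  rw [h1]
  refine setIntegral_congr_fun measurableSet_Ioi fun τ hτ => ?_
  simp [cutBelow_of_le f (le_of_lt hτ)]

end Near

end Literature.Analysis.Fourier
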